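import Mathlib
import Literature.NumberTheory.Automorphic.ResGLnHermitianConeOpen
import HarnessLib

/-!
# Smooth local sections of the hermitian square `g ↦ g gᴴ` —
crux HeckeEigenvalueField (stmt-Langlands-13632), line Sketch, stub DICT-W3

Statement.  Let `K` be a number field, `K_∞ = mixedSpace K = ℝ^{r₁} × ℂ^{r₂}`, and
`M = M_n(K_∞)` (sup-of-row-sums operator norm, scope `Matrix.Norms.Operator`).  For an invertible
`g₀ ∈ M` and the point `H₀ = g₀ g₀ᴴ` of the hermitian space `hermSpace n K = {H | Hᴴ = H}`
(`Literature/NumberTheory/Automorphic/ResGLnHermitianCone.lean`) there is a map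
`s : hermSpace n K → M`, smooth near `H₀`, with `s H₀ = g₀`, `s(H) s(H)ᴴ = H` and `s H` invertible
for all `H` near `H₀`: a smooth local section through `g₀` of the submersion `p : g ↦ g gᴴ` of
`GL_n(K_∞)` onto the cone of positive hermitian matrices.

Proof (inverse function theorem).  Put `b = g₀⁻¹`, `a = bᴴ = g₀⁻ᴴ` and, for `v` hermitian,
`F₁ v = g₀ + ½ v a`, `F₂ v = g₀ᴴ + ½ b v = (F₁ v)ᴴ`, `G v = F₁ v F₂ v` (a hermitian matrix) and
`f v = P (G v) ∈ hermSpace n K`, where `P m = ½ (m + mᴴ)` is the (continuous, linear) projection of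
`M` onto the hermitian space.  The map `f : hermSpace → hermSpace` is polynomial, hence `C^ω`, and
its derivative at `0` is `w ↦ P (g₀ · ½ b w + ½ w a · g₀ᴴ) = P (½ w + ½ w) = w`, the identity.  By
the inverse function theorem (`ContDiffAt.localInverse`) `f` has a local inverse `φ`, `C^ω` at
`f 0 = H₀`, hence `C^∞` on a neighbourhood of `H₀`, with `f (φ H) = H` near `H₀` and `φ H₀ = 0`.
Then `s = F₁ ∘ φ` works: `s H₀ = F₁ 0 = g₀`, `s(H) s(H)ᴴ = G (φ H) = f (φ H) = H` near `H₀`, and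
`s H` is invertible near `H₀` because `s` is continuous at `H₀`, `s H₀ = g₀` is a unit and the
units of the complete normed ring `M` form an open set (`Units.isOpen`).

This is the calculus input making the cone form `ω_c(H)` of the Borel–Wallach dictionary a local
pullback of the left-trivialised form on the group.  Standard (local sections of submersions).
-/

set_option linter.dupNamespace false -- project-wide: `Summit.Langlands.Langlands` is the mandated namespace

noncomputable section

open scoped Matrix.Norms.Operator ContDiff Topology Matrix Classical
open Filter NumberField NumberField.mixedEmbedding
open Literature.NumberTheory.Automorphic

namespace Summit.Langlands.Langlands.Theorems.HeckeEigenvalueField.Res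

/-- **Dictionary calculus W3: smooth local sections of the hermitian square `g ↦ g gᴴ`.**  Near
every point `H₀ = g₀ g₀ᴴ` (`g₀` invertible) there is a map `s` from the hermitian space to
`M_n(K_∞)`, smooth near `H₀`, with `s H₀ = g₀`, `s(H) s(H)ᴴ = H` and `s H` invertible near `H₀`
(inverse function theorem for `v ↦ (g₀ + ½ v g₀⁻ᴴ)(g₀ + ½ v g₀⁻ᴴ)ᴴ`, whose derivative at `0` is
the identity of the hermitian space). [folklore] -/
theorem stub_hermSquare_localSection (n : ℕ) (K : Type) [Field K] [NumberField K]
    (g₀ : Matrix (Fin n) (Fin n) (mixedSpace K)) (hg₀ : IsUnit g₀) (H₀ : ResGLnCone.hermSpace n K)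
    (hH₀ : (H₀ : Matrix (Fin n) (Fin n) (mixedSpace K)) = g₀ * g₀ᴴ) :
    ∃ s : ResGLnCone.hermSpace n K → Matrix (Fin n) (Fin n) (mixedSpace K),
      s H₀ = g₀ ∧ (∀ᶠ H in 𝓝 H₀, ContDiffAt ℝ ∞ s H) ∧
        (∀ᶠ H in 𝓝 H₀, s H * (s H)ᴴ = (H : Matrix (Fin n) (Fin n) (mixedSpace K))) ∧
          ∀ᶠ H in 𝓝 H₀, IsUnit (s H) := by
  obtain ⟨u, rfl⟩ := hg₀
  -- `b = g₀⁻¹`, `a = bᴴ = g₀⁻ᴴ`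
  set b : Matrix (Fin n) (Fin n) (mixedSpace K) := ↑u⁻¹
  set a : Matrix (Fin n) (Fin n) (mixedSpace K) := bᴴ with ha
  have hub : (u : Matrix (Fin n) (Fin n) (mixedSpace K)) * b = 1 := u.mul_inv
  have hau : a * (u : Matrix (Fin n) (Fin n) (mixedSpace K))ᴴ = 1 := by
    rw [ha, ← Matrix.conjTranspose_mul, hub, Matrix.conjTranspose_one]
  -- the inclusion `ι : hermSpace → M` and the projection `P : M → hermSpace`, `P m = ½ (m + mᴴ)`
  let ι : ResGLnCone.hermSpace n K →L[ℝ] Matrix (Fin n) (Fin n) (mixedSpace K) :=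
    LinearMap.toContinuousLinearMap (ResGLnCone.hermSpace n K).subtype
  let Pₗ : Matrix (Fin n) (Fin n) (mixedSpace K) →ₗ[ℝ] ResGLnCone.hermSpace n K :=
    { toFun := fun m => ⟨(1 / 2 : ℝ) • (m + mᴴ), by
        rw [ResGLnCone.mem_hermSpace_iff, Matrix.conjTranspose_smul, Matrix.conjTranspose_add,
          Matrix.conjTranspose_conjTranspose, star_trivial, add_comm]⟩
      map_add' := fun m m' => Subtype.ext (by
        simp only [Submodule.coe_add, Matrix.conjTranspose_add, ← smul_add]
        congr 1
        abel)
      map_smul' := fun c m => Subtype.ext (by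
        simp only [Submodule.coe_smul, RingHom.id_apply, Matrix.conjTranspose_smul, star_trivial,
          ← smul_add]
        rw [smul_comm]) }
  let P : Matrix (Fin n) (Fin n) (mixedSpace K) →L[ℝ] ResGLnCone.hermSpace n K :=
    LinearMap.toContinuousLinearMap Pₗ
  have hP : ∀ m : Matrix (Fin n) (Fin n) (mixedSpace K), mᴴ = m →
      ((P m : ResGLnCone.hermSpace n K) : Matrix (Fin n) (Fin n) (mixedSpace K)) = m := by
    intro m hm
    show (1 / 2 : ℝ) • (m + mᴴ) = m
    rw [hm, ← two_smul ℝ m, smul_smul]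
    norm_num
  have hPv : ∀ v : ResGLnCone.hermSpace n K, P (v : Matrix (Fin n) (Fin n) (mixedSpace K)) = v :=
    fun v => Subtype.ext (hP _ v.2)
  -- the two affine factors `F₁ v = g₀ + ½ v a`, `F₂ v = g₀ᴴ + ½ b v = (F₁ v)ᴴ`
  let L₁ : ResGLnCone.hermSpace n K →L[ℝ] Matrix (Fin n) (Fin n) (mixedSpace K) :=
    (1 / 2 : ℝ) • (((ContinuousLinearMap.mul ℝ (Matrix (Fin n) (Fin n) (mixedSpace K))).flip a).comp ι)
  let L₂ : ResGLnCone.hermSpace n K →L[ℝ] Matrix (Fin n) (Fin n) (mixedSpace K) :=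
    (1 / 2 : ℝ) • ((ContinuousLinearMap.mul ℝ (Matrix (Fin n) (Fin n) (mixedSpace K)) b).comp ι)
  have hL₁ : ∀ v, L₁ v = (1 / 2 : ℝ) • ((v : Matrix (Fin n) (Fin n) (mixedSpace K)) * a) :=
    fun v => rfl
  have hL₂ : ∀ v, L₂ v = (1 / 2 : ℝ) • (b * (v : Matrix (Fin n) (Fin n) (mixedSpace K))) :=
    fun v => rfl
  let F₁ : ResGLnCone.hermSpace n K → Matrix (Fin n) (Fin n) (mixedSpace K) := fun v => ↑u + L₁ v
  let F₂ : ResGLnCone.hermSpace n K → Matrix (Fin n) (Fin n) (mixedSpace K) := fun v => (↑u)ᴴ + L₂ v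
  have hF₁₂ : ∀ v, (F₁ v)ᴴ = F₂ v := by
    intro v
    simp only [F₁, F₂, hL₁, hL₂, Matrix.conjTranspose_add, Matrix.conjTranspose_smul,
      Matrix.conjTranspose_mul, ha, Matrix.conjTranspose_conjTranspose, star_trivial]
    rw [show (v : Matrix (Fin n) (Fin n) (mixedSpace K))ᴴ = v from v.2]
  let G : ResGLnCone.hermSpace n K → Matrix (Fin n) (Fin n) (mixedSpace K) := fun v => F₁ v * F₂ v
  have hGherm : ∀ v, (G v)ᴴ = G v := by
    intro v
    show (F₁ v * F₂ v)ᴴ = F₁ v * F₂ v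
    rw [Matrix.conjTranspose_mul, ← hF₁₂, Matrix.conjTranspose_conjTranspose]
  let f : ResGLnCone.hermSpace n K → ResGLnCone.hermSpace n K := fun v => P (G v)
  have hfG : ∀ v, ((f v : ResGLnCone.hermSpace n K) : Matrix (Fin n) (Fin n) (mixedSpace K)) = G v :=
    fun v => hP _ (hGherm v)
  -- smoothness of `f`
  have hF₁_smooth : ContDiff ℝ ω F₁ := contDiff_const.add L₁.contDiff
  have hF₂_smooth : ContDiff ℝ ω F₂ := contDiff_const.add L₂.contDiff
  have hG_smooth : ContDiff ℝ ω G := hF₁_smooth.mul hF₂_smooth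
  have hf : ContDiffAt ℝ ω f 0 := (P.contDiff.comp hG_smooth).contDiffAt
  -- the derivative of `f` at `0` is the identity
  have hF₁0 : F₁ 0 = ↑u := by simp [F₁]
  have hF₂0 : F₂ 0 = (↑u)ᴴ := by simp [F₂]
  have hG' : HasFDerivAt G (F₁ 0 • L₂ + MulOpposite.op (F₂ 0) • L₁) 0 :=
    ((L₁.hasFDerivAt).const_add _).fun_mul' ((L₂.hasFDerivAt).const_add _)
  have hf' : HasFDerivAt f ((ContinuousLinearEquiv.refl ℝ (ResGLnCone.hermSpace n K) :
      ResGLnCone.hermSpace n K ≃L[ℝ] ResGLnCone.hermSpace n K) :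
        ResGLnCone.hermSpace n K →L[ℝ] ResGLnCone.hermSpace n K) 0 := by
    refine ((P.hasFDerivAt).comp 0 hG').congr_fderiv (ContinuousLinearMap.ext fun w => ?_)
    show P (F₁ 0 * L₂ w + L₁ w * F₂ 0) = w
    rw [hF₁0, hF₂0, hL₁, hL₂, Matrix.mul_smul, Matrix.smul_mul, ← Matrix.mul_assoc, hub,
      Matrix.one_mul, Matrix.mul_assoc, hau, Matrix.mul_one, ← add_smul,
      show (1 / 2 : ℝ) + 1 / 2 = 1 by norm_num, one_smul]
    exact hPv w
  -- the inverse function theorem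
  have hn : (ω : WithTop ℕ∞) ≠ 0 := by simp
  have hf0 : f 0 = H₀ := by
    refine Subtype.ext ?_
    rw [hfG, hH₀]
    show F₁ 0 * F₂ 0 = _
    rw [hF₁0, hF₂0]
  set φ := hf.localInverse hf' hn
  have hφ_at : ContDiffAt ℝ ω φ H₀ := by
    have h1 := hf.to_localInverse hf' hn
    rwa [hf0] at h1
  have hφ_smooth : ∀ᶠ H in 𝓝 H₀, ContDiffAt ℝ ∞ φ H := by
    filter_upwards [hφ_at.eventually (by simp)] with H hH using hH.of_le le_top
  have hφ_right : ∀ᶠ H in 𝓝 H₀, f (φ H) = H := by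
    have := (hf.hasStrictFDerivAt' hf' hn).eventually_right_inverse
    rwa [hf0] at this
  have hφ0 : φ H₀ = 0 := by
    have := hf.localInverse_apply_image hf' hn
    rwa [hf0] at this
  -- the section `s = F₁ ∘ φ`
  refine ⟨fun H => F₁ (φ H), ?_, ?_, ?_, ?_⟩
  · show F₁ (φ H₀) = ↑u
    rw [hφ0, hF₁0]
  · filter_upwards [hφ_smooth] with H hH
    exact (hF₁_smooth.of_le le_top).contDiffAt.comp H hH
  · filter_upwards [hφ_right] with H hH
    show F₁ (φ H) * (F₁ (φ H))ᴴ = _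
    rw [hF₁₂]
    exact (hfG (φ H)).symm.trans (congrArg Subtype.val hH)
  · have hs_cont : ContinuousAt (F₁ ∘ φ) H₀ :=
      hF₁_smooth.continuous.continuousAt.comp hφ_at.continuousAt
    have hmem : {x : Matrix (Fin n) (Fin n) (mixedSpace K) | IsUnit x} ∈ 𝓝 ((F₁ ∘ φ) H₀) := by
      rw [Function.comp_apply, hφ0, hF₁0]
      exact Units.isOpen.mem_nhds u.isUnit
    exact hs_cont.eventually_mem hmem

end Summit.Langlands.Langlands.Theorems.HeckeEigenvalueField.Res

end
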